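import Summits.BirchSwinnertonDyer.Rank1Residual.Additive.BudgetFromTamagawaCertificatesLayerAll
import Summits.BirchSwinnertonDyer.Rank1Residual.Additive.SplitMultiplicativeWitnessKodairaNeron
import Literature.NumberTheory.EllipticCurves.NonsplitProofs
import HarnessLib

/-!
# The Route-G budget at level `n` from census certificates over `ℚ` — MAIN WITHOUT TATE'S
# UNIFORMISATION (row T-L1-KN2 FILE 3, seat p01 GEN 4, written at n1011-p10's request "one author
# per file"; the A40-free twin of p10's statement of record `BudgetFromTamagawaCertificatesLayerAll`)

HONEST FRAMING (cell `b2b-bsdres`, run/shared/lean/b2b/bsd-rank1-residual/, verbatim in every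
file): the goal of the cell is to DELETE the COMBINATION-SHAPED residual classes of the
Birch–Swinnerton-Dyer formula for ALL analytic-rank `≤ 1` elliptic curves over `ℚ` — "full BSD
formula for every rank `≤ 1` curve in class `C`" assembled STRICTLY from published theorems — so
that the rank-`≤ 1` remainder becomes exactly the CONSTRUCTION-SHAPED classes, which are TYPED
(missing-input `Prop`s), NOT attempted. This is not "finishing BSD". Team n1011 (N10/N11, the
Route-G LOWER budget node of the CONSTRUCTION-SHAPED classes X3♯/X4♯): research route; nothing is
booked by this file; no mark / label moved. THEOREMS ONLY: no definition, no named fact, no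
`sorry`; census certificates enter as HYPOTHESES per row, never as facts.

## What

n1011-p10's MAIN `budgetLeLambdaAt_layer_of_certificates` (`BudgetFromTamagawaCertificatesLayerAll`,
row T-E3g-BUDn-CERT, referee 1 GEN 16 FLAG-2 statement of record) carries the hypothesis
`hU : Silverman1994_thmV53_tateUniformisation` (named fact A40), used on the split-multiplicative
rows only, through this seat's gen-3 witness. Row T-L1-KN2 (`SplitMultiplicativeWitnessKodairaNeron`,
`…Local`) re-proved that witness from Kodaira–Néron over `K_v^nr` WITHOUT the Tate curve. This
file is p10's assembly with the split branch fed by the A40-free witness — the SAME conclusions,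
`hU` DELETED; the remaining named inputs are Greenberg Prop. 4.14 (`h414`), Poitou–Tate duality
(`hPT`) and the local Euler–Poincaré formula (`hEP`) over `ℚ_n`:

* `exists_mem_unramifiedSubgroup_not_mem_kummerLocalConditionAt_layer_of_tamagawaRow_noTate` — the
  layer witness on a Tamagawa row (additive: n1011-p06 / p10 FILE 2a; split multiplicative:
  T-L1-KN2), no named fact;
* `budgetLeLambdaAt_layer_of_certificates_of_hres_noTate`, **`budgetLeLambdaAt_layer_of_certificates_noTate`**
  (MAIN: `BudgetLeLambdaAt p W (Σ_{v ∈ S} p^{min(n, m_v)})` from the census certificates on every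
  additive and every split-multiplicative Tamagawa row, modulo `h414` / `hPT` / `hEP` ONLY),
  `residualSelmerRankGeAt_layer_of_certificates_noTate` — p10's three theorems verbatim minus `hU`.

* §2 (addendum) `hasAdditiveReductionAt_or_hasSplitMultiplicativeReductionAt_of_dvd_localTamagawaNumber`
  — for ODD `p`, `p ∣ c_v` already FORCES additive or split multiplicative reduction at `v`
  (`c_v = 1` at a good place, `c_v ∈ {1, 2}` at a non-split multiplicative place — tree theorems
  `localTamagawaNumber_eq_one_of_hasGoodReductionAt_holds`,
  `localTamagawaNumber_of_hasNonsplitMultiplicativeReductionAt_holds`), so the reduction-type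
  hypothesis `hdat` is discharged too: `…_layer_of_dvd_localTamagawaNumber`,
  `budgetLeLambdaAt_layer_of_certificates_of_hres_of_dvd`, **`budgetLeLambdaAt_layer_of_certificates_of_dvd`**
  (MAIN from the THREE census columns `v ∤ p`, `v_p(N(v)^{p−1} − 1) = m_v + 1`, `p ∣ c_v`, modulo
  `h414` / `hPT` / `hEP` only), `residualSelmerRankGeAt_layer_of_certificates_of_dvd`.

p10's `hU` forms stay as dominated twins (referee 1 GEN 17 ACK-1 on T-L1-KN2). HONEST LIMITS: as
in p10's file — one inequality per layer `n`; split multiplicative and additive rows only (for odd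
`p` these are all Tamagawa rows with `p ∣ c_v` at `v ∤ p`, §2); named facts as listed.

References: R. Greenberg, LNM 1716 (1999) §3 p. 74, §5 pp. 114–118 and Prop. 4.14
[GreenbergLNM1716]; J. H. Silverman, *ATAEC* Cor. IV.9.2 (d) [SilvermanATAEC1994]; L. C.
Washington, *Introduction to Cyclotomic Fields* §13.1, Prop. 13.2 [Washington1997]; ROUTE-2 II.17,
II.21 (cells/n1011/).
-/

set_option autoImplicit false

noncomputable section

open scoped Classical

open Function Field NumberField IsDedekindDomain WeierstrassCurve
open Literature.NumberTheory.EllipticCurves Literature.NumberTheory.GaloisRepresentations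
open Literature.NumberTheory.GaloisRepresentations.DiscreteGaloisModule (unramifiedSubgroup)
open Literature.NumberTheory.GaloisCohomology

namespace Summit.BirchSwinnertonDyer.Rank1Residual.Additive

variable {W : WeierstrassCurve ℚ} [W.IsElliptic] [W.IsGloballyMinimal] {p : ℕ} [hp : Fact p.Prime]

/-- **The layer witness on a Tamagawa row, no named fact** (additive OR split multiplicative at
`v ∤ p`, `p ∣ c_v`), at every place `w ∣ v` of the layer `ℚ_n` of any `ℤ_p`-extension: FILE 2a's
additive witness / row T-L1-KN2's split-multiplicative witness from Kodaira–Néron (no Tate curve) —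
n1011-p10's `…_layer_of_tamagawaRow` with `hU` deleted.
[cite: GreenbergLNM1716, §2 p. 74, §3 p. 74 and §5 (406D1)] [cite: SilvermanATAEC1994, Cor. IV.9.2(d) (PDF p. 340)] -/
theorem exists_mem_unramifiedSubgroup_not_mem_kummerLocalConditionAt_layer_of_tamagawaRow_noTate
    (hodd : p ≠ 2) (κ : ZpExtension ℚ p)
    (n : ℕ) {v : HeightOneSpectrum (𝓞 ℚ)} (hpv : ((p : ℕ) : 𝓞 ℚ) ∉ v.asIdeal)
    (hcv : p ∣ (W.baseChange (v.adicCompletion ℚ)).localTamagawaNumber (v.adicCompletionIntegers ℚ))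
    (hdat : W.HasAdditiveReductionAt v ∨ W.HasSplitMultiplicativeReductionAt v)
    (w : HeightOneSpectrum (𝓞 (κ.layer n))) (hw : w.under (𝓞 ℚ) = v) :
    ∃ u ∈ unramifiedSubgroup
        (((W.baseChange (κ.layer n)).torsionGaloisModule (p : ℤ)).restrictField
          (w.adicCompletion (κ.layer n))) 1,
      u ∉ (W.baseChange (κ.layer n)).kummerLocalConditionAt (p : ℤ)
        (w.adicCompletion (κ.layer n)) := by
  rcases hdat with hadd | hsplit
  · exact exists_mem_unramifiedSubgroup_not_mem_kummerLocalConditionAt_layer_of_hasAdditiveReductionAt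
      W κ n hpv hodd hadd hcv w hw
  · exact exists_mem_unramifiedSubgroup_not_mem_kummerLocalConditionAt_baseChange_of_split_of_dvd_localTamagawaNumber_kodairaNeron'
      W p w hpv hsplit hcv hw

/-- **MAIN without Tate's uniformisation, transport kept as a binder** (for consumers compiled
against N2's `hres` shape): `BudgetLeLambdaAt p W (Σ_{v ∈ S} p^{min(n, m_v)})` from the census
certificates on every additive and every split-multiplicative Tamagawa row `v ∈ S`, modulo
Greenberg 4.14 / Poitou–Tate / Euler–Poincaré only — n1011-p10's
`budgetLeLambdaAt_layer_of_certificates_of_hres` with `hU` deleted.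
[cite: GreenbergLNM1716, §5 pp. 114–118 and Prop. 4.14] [cite: Washington1997, §13.1 and Prop. 13.2]
[cite: SilvermanATAEC1994, Cor. IV.9.2(d) (PDF p. 340)] -/
theorem budgetLeLambdaAt_layer_of_certificates_of_hres_noTate (hodd : p ≠ 2)
    (h414 : Greenberg1999.prop414_noFiniteSubmodule_of_not_dvd_torsionOrder)
    (htors : ¬ p ∣ W.torsionOrder) (n : ℕ)
    (hres : ∀ (κ : ZpExtension ℚ p) [NumberField (κ.layer n)], κ.IsCyclotomic →
      ∃ κ' : ZpExtension (κ.layer n) p,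
        (∀ σ : absoluteGaloisGroup (κ.layer n),
          (κ' σ).toAdd * (p : ℤ_[p]) ^ n = (κ (resGal (K := ℚ) (κ.layer n) σ)).toAdd) ∧
        ∃ f : (W.baseChange (κ.layer n)).selmerInfty κ' →+ W.selmerInfty κ, Injective f)
    (hPT : ∀ (κ : ZpExtension ℚ p) [NumberField (κ.layer n)], κ.IsCyclotomic →
      poitouTate_selmerStructure_duality (κ.layer n))
    (hEP : ∀ (κ : ZpExtension ℚ p) [NumberField (κ.layer n)], κ.IsCyclotomic →
      ∀ w : HeightOneSpectrum (𝓞 (κ.layer n)),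
      localEulerPoincareCharacteristic (w.adicCompletion (κ.layer n)))
    (S : Finset (HeightOneSpectrum (𝓞 ℚ))) (m : HeightOneSpectrum (𝓞 ℚ) → ℕ)
    (hSp : ∀ v ∈ S, ((p : ℕ) : 𝓞 ℚ) ∉ v.asIdeal)
    (hval : ∀ v ∈ S, padicValNat p (v.residueCard ^ (p - 1) - 1) = m v + 1)
    (hcv : ∀ v ∈ S,
      p ∣ (W.baseChange (v.adicCompletion ℚ)).localTamagawaNumber (v.adicCompletionIntegers ℚ))
    (hdat : ∀ v ∈ S, W.HasAdditiveReductionAt v ∨ W.HasSplitMultiplicativeReductionAt v) :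
    BudgetLeLambdaAt p W (∑ v ∈ S, p ^ min n (m v)) :=
  budgetLeLambdaAt_layer_of_padicValNat hodd h414 htors n hres hPT hEP S m hSp hval
    fun v hv κ _ w hw ↦
      exists_mem_unramifiedSubgroup_not_mem_kummerLocalConditionAt_layer_of_tamagawaRow_noTate hodd κ
        n (hSp v hv) (hcv v hv) (hdat v hv) w hw

/-- **THE ROUTE-G BUDGET AT LEVEL `n` FROM CENSUS CERTIFICATES OVER `ℚ`, WITHOUT TATE'S
UNIFORMISATION (MAIN).** Let `E = W/ℚ` be globally minimal, `p` an odd prime with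
`p ∤ #E(ℚ)_tors`, `n : ℕ`, and `S` a finite set of places `v` of `ℚ`, each carrying: `v ∤ p`; a
place-count certificate `v_p(N(v)^{p−1} − 1) = m_v + 1`; `p ∣ c_v` (`localTamagawaNumber` of
`E ⊗ ℚ_v`); additive OR split multiplicative reduction at `v`. Then, modulo the named facts
Greenberg Prop. 4.14 (`h414`), Poitou–Tate duality over `ℚ_n` (`hPT`) and the local Euler–Poincaré
formula at the places of `ℚ_n` (`hEP`) — and NOTHING ELSE (no A40):
**`BudgetLeLambdaAt p W (Σ_{v ∈ S} p^{min(n, m_v)})`**, i.e. `λ(X(E/ℚ_∞)) ≥ Σ_v p^{min(n, m_v)}`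
for every torsion Selmer-dual datum with `μ = 0`. n1011-p10's `budgetLeLambdaAt_layer_of_certificates`
(statement of record of row T-E3g-BUDn-CERT) with `hU` deleted: the split-multiplicative layer
witness now comes from Kodaira–Néron (row T-L1-KN2), the transport from row T-res
(`ZpTower.exists_selmerInfty_restrictTower_injective`).
[cite: GreenbergLNM1716, §5 pp. 114–118 and Prop. 4.14] [cite: Washington1997, §13.1 and Prop. 13.2]
[cite: SilvermanATAEC1994, Cor. IV.9.2(d) (PDF p. 340)] -/
theorem budgetLeLambdaAt_layer_of_certificates_noTate (hodd : p ≠ 2)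
    (h414 : Greenberg1999.prop414_noFiniteSubmodule_of_not_dvd_torsionOrder)
    (htors : ¬ p ∣ W.torsionOrder) (n : ℕ)
    (hPT : ∀ (κ : ZpExtension ℚ p) [NumberField (κ.layer n)], κ.IsCyclotomic →
      poitouTate_selmerStructure_duality (κ.layer n))
    (hEP : ∀ (κ : ZpExtension ℚ p) [NumberField (κ.layer n)], κ.IsCyclotomic →
      ∀ w : HeightOneSpectrum (𝓞 (κ.layer n)),
      localEulerPoincareCharacteristic (w.adicCompletion (κ.layer n)))
    (S : Finset (HeightOneSpectrum (𝓞 ℚ))) (m : HeightOneSpectrum (𝓞 ℚ) → ℕ)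
    (hSp : ∀ v ∈ S, ((p : ℕ) : 𝓞 ℚ) ∉ v.asIdeal)
    (hval : ∀ v ∈ S, padicValNat p (v.residueCard ^ (p - 1) - 1) = m v + 1)
    (hcv : ∀ v ∈ S,
      p ∣ (W.baseChange (v.adicCompletion ℚ)).localTamagawaNumber (v.adicCompletionIntegers ℚ))
    (hdat : ∀ v ∈ S, W.HasAdditiveReductionAt v ∨ W.HasSplitMultiplicativeReductionAt v) :
    BudgetLeLambdaAt p W (∑ v ∈ S, p ^ min n (m v)) :=
  budgetLeLambdaAt_layer_of_certificates_of_hres_noTate hodd h414 htors n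
    (fun κ _ _ ↦ ZpTower.exists_selmerInfty_restrictTower_injective W κ n) hPT hEP S m hSp hval
    hcv hdat

/-- **The residual count at level `n` from census certificates, without Tate's uniformisation**
(twin of the MAIN, transport discharged; plus finiteness of `Sel_{p^∞}(E/ℚ_∞)[p]`):
`ResidualSelmerRankGeAt p W (Σ_{v ∈ S} p^{min(n, m_v)})` — n1011-p10's
`residualSelmerRankGeAt_layer_of_certificates` with `hU` deleted.
[cite: GreenbergLNM1716, §5 pp. 114–118] [cite: Washington1997, §13.1]
[cite: SilvermanATAEC1994, Cor. IV.9.2(d) (PDF p. 340)] -/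
theorem residualSelmerRankGeAt_layer_of_certificates_noTate (hodd : p ≠ 2)
    (htors : ¬ p ∣ W.torsionOrder) (n : ℕ)
    (hfin : ∀ (κ : ZpExtension ℚ p), κ.IsCyclotomic → Finite {s : W.selmerInfty κ // p • s = 0})
    (hPT : ∀ (κ : ZpExtension ℚ p) [NumberField (κ.layer n)], κ.IsCyclotomic →
      poitouTate_selmerStructure_duality (κ.layer n))
    (hEP : ∀ (κ : ZpExtension ℚ p) [NumberField (κ.layer n)], κ.IsCyclotomic →
      ∀ w : HeightOneSpectrum (𝓞 (κ.layer n)),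
      localEulerPoincareCharacteristic (w.adicCompletion (κ.layer n)))
    (S : Finset (HeightOneSpectrum (𝓞 ℚ))) (m : HeightOneSpectrum (𝓞 ℚ) → ℕ)
    (hSp : ∀ v ∈ S, ((p : ℕ) : 𝓞 ℚ) ∉ v.asIdeal)
    (hval : ∀ v ∈ S, padicValNat p (v.residueCard ^ (p - 1) - 1) = m v + 1)
    (hcv : ∀ v ∈ S,
      p ∣ (W.baseChange (v.adicCompletion ℚ)).localTamagawaNumber (v.adicCompletionIntegers ℚ))
    (hdat : ∀ v ∈ S, W.HasAdditiveReductionAt v ∨ W.HasSplitMultiplicativeReductionAt v) :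
    ResidualSelmerRankGeAt p W (∑ v ∈ S, p ^ min n (m v)) :=
  residualSelmerRankGeAt_layer_of_padicValNat hodd htors n hfin
    (fun κ _ _ ↦ ZpTower.exists_selmerInfty_restrictTower_injective W κ n) hPT hEP S m hSp hval
    fun v hv κ _ w hw ↦
      exists_mem_unramifiedSubgroup_not_mem_kummerLocalConditionAt_layer_of_tamagawaRow_noTate hodd κ
        n (hSp v hv) (hcv v hv) (hdat v hv) w hw

/-! ## §2 (addendum, same seat) The reduction-type datum `hdat` is IMPLIED by `p ∣ c_v` for odd
`p`: at a good place `c_v = 1`, at a non-split multiplicative place `c_v ∈ {1, 2}` (both tree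
theorems) — so the MAIN's per-row hypotheses shrink to the three census columns `v ∤ p`,
`v_p(N(v)^{p−1} − 1) = m_v + 1`, `p ∣ c_v`. -/

section ReductionType

variable {K : Type} [Field K] [NumberField K] (V : WeierstrassCurve K) [V.IsElliptic]
  (v : HeightOneSpectrum (𝓞 K))

/-- **An odd prime dividing `c_v` forces additive or split multiplicative reduction at `v`.** For an
elliptic curve `E = V` over a number field `K`, a finite place `v` and an odd prime `p` with
`p ∣ c_v` (`localTamagawaNumber` of `E ⊗ K_v`): `E` has additive or split multiplicative reduction at
`v` — by the local trichotomy (Silverman *AEC* VII.5.1), `c_v = 1` at a place of good reduction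
(tree `localTamagawaNumber_eq_one_of_hasGoodReductionAt_holds`) and `c_v ∈ {1, 2}` at a place of
non-split multiplicative reduction (Tate's algorithm Step 2, Silverman *ATAEC* IV.9.4; tree
`localTamagawaNumber_of_hasNonsplitMultiplicativeReductionAt_holds`).
[cite: SilvermanATAEC1994, IV.9.4 Step 2 (PDF p. 344) with Rem. IV.9.3 (PDF p. 341)]
[cite: SilvermanAEC2009, VII.5 Prop. 5.1 and VII.2 remark after Prop. 2.1 (PDF p. 169)] -/
theorem hasAdditiveReductionAt_or_hasSplitMultiplicativeReductionAt_of_dvd_localTamagawaNumber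
    [Finite (IsLocalRing.ResidueField (v.adicCompletionIntegers K))] (hodd : p ≠ 2)
    (hc : p ∣ (V.baseChange (v.adicCompletion K)).localTamagawaNumber (v.adicCompletionIntegers K)) :
    V.HasAdditiveReductionAt v ∨ V.HasSplitMultiplicativeReductionAt v := by
  rcases V.hasGoodReductionAt_or_hasMultiplicativeReductionAt_or_hasAdditiveReductionAt v with
    hgood | hmult | hadd
  · rw [V.localTamagawaNumber_eq_one_of_hasGoodReductionAt_holds v hgood, Nat.dvd_one] at hc
    exact absurd hc hp.out.one_lt.ne'
  · by_cases hs : V.HasSplitMultiplicativeReductionAt v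
    · exact Or.inr hs
    · rw [localTamagawaNumber_of_hasNonsplitMultiplicativeReductionAt_holds v V hmult hs] at hc
      exfalso
      split_ifs at hc
      · exact hodd ((Nat.prime_dvd_prime_iff_eq hp.out Nat.prime_two).mp hc)
      · rw [Nat.dvd_one] at hc
        exact hp.out.one_lt.ne' hc
  · exact Or.inl hadd

end ReductionType

/-- **The layer witness on a Tamagawa row from `p ∣ c_v` ALONE** (`p` odd, `v ∤ p`): the
reduction-type disjunction of `…_layer_of_tamagawaRow_noTate` is discharged by
`hasAdditiveReductionAt_or_hasSplitMultiplicativeReductionAt_of_dvd_localTamagawaNumber`.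
[cite: GreenbergLNM1716, §2 p. 74, §3 p. 74 and §5 (406D1)] [cite: SilvermanATAEC1994, Cor. IV.9.2(d) (PDF p. 340), IV.9.4 Step 2 (PDF p. 344)] -/
theorem exists_mem_unramifiedSubgroup_not_mem_kummerLocalConditionAt_layer_of_odd_of_dvd_localTamagawaNumber
    (hodd : p ≠ 2) (κ : ZpExtension ℚ p)
    (n : ℕ) {v : HeightOneSpectrum (𝓞 ℚ)} (hpv : ((p : ℕ) : 𝓞 ℚ) ∉ v.asIdeal)
    (hcv : p ∣ (W.baseChange (v.adicCompletion ℚ)).localTamagawaNumber (v.adicCompletionIntegers ℚ))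
    (w : HeightOneSpectrum (𝓞 (κ.layer n))) (hw : w.under (𝓞 ℚ) = v) :
    ∃ u ∈ unramifiedSubgroup
        (((W.baseChange (κ.layer n)).torsionGaloisModule (p : ℤ)).restrictField
          (w.adicCompletion (κ.layer n))) 1,
      u ∉ (W.baseChange (κ.layer n)).kummerLocalConditionAt (p : ℤ)
        (w.adicCompletion (κ.layer n)) :=
  haveI : Finite (IsLocalRing.ResidueField (v.adicCompletionIntegers ℚ)) :=
    HeightOneSpectrum.finite_residueField_adicCompletionIntegers ℚ v
  exists_mem_unramifiedSubgroup_not_mem_kummerLocalConditionAt_layer_of_tamagawaRow_noTate hodd κ n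
    hpv hcv
    (hasAdditiveReductionAt_or_hasSplitMultiplicativeReductionAt_of_dvd_localTamagawaNumber W v hodd
      hcv) w hw

/-- **MAIN from the three census columns, transport kept as a binder**: as
`budgetLeLambdaAt_layer_of_certificates_of_hres_noTate` with the reduction-type hypothesis `hdat`
DISCHARGED (`p` odd and `p ∣ c_v` force additive or split multiplicative reduction).
[cite: GreenbergLNM1716, §5 pp. 114–118 and Prop. 4.14] [cite: Washington1997, §13.1 and Prop. 13.2]
[cite: SilvermanATAEC1994, Cor. IV.9.2(d) (PDF p. 340), IV.9.4 Step 2 (PDF p. 344)] -/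
theorem budgetLeLambdaAt_layer_of_certificates_of_hres_of_dvd (hodd : p ≠ 2)
    (h414 : Greenberg1999.prop414_noFiniteSubmodule_of_not_dvd_torsionOrder)
    (htors : ¬ p ∣ W.torsionOrder) (n : ℕ)
    (hres : ∀ (κ : ZpExtension ℚ p) [NumberField (κ.layer n)], κ.IsCyclotomic →
      ∃ κ' : ZpExtension (κ.layer n) p,
        (∀ σ : absoluteGaloisGroup (κ.layer n),
          (κ' σ).toAdd * (p : ℤ_[p]) ^ n = (κ (resGal (K := ℚ) (κ.layer n) σ)).toAdd) ∧
        ∃ f : (W.baseChange (κ.layer n)).selmerInfty κ' →+ W.selmerInfty κ, Injective f)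
    (hPT : ∀ (κ : ZpExtension ℚ p) [NumberField (κ.layer n)], κ.IsCyclotomic →
      poitouTate_selmerStructure_duality (κ.layer n))
    (hEP : ∀ (κ : ZpExtension ℚ p) [NumberField (κ.layer n)], κ.IsCyclotomic →
      ∀ w : HeightOneSpectrum (𝓞 (κ.layer n)),
      localEulerPoincareCharacteristic (w.adicCompletion (κ.layer n)))
    (S : Finset (HeightOneSpectrum (𝓞 ℚ))) (m : HeightOneSpectrum (𝓞 ℚ) → ℕ)
    (hSp : ∀ v ∈ S, ((p : ℕ) : 𝓞 ℚ) ∉ v.asIdeal)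
    (hval : ∀ v ∈ S, padicValNat p (v.residueCard ^ (p - 1) - 1) = m v + 1)
    (hcv : ∀ v ∈ S,
      p ∣ (W.baseChange (v.adicCompletion ℚ)).localTamagawaNumber (v.adicCompletionIntegers ℚ)) :
    BudgetLeLambdaAt p W (∑ v ∈ S, p ^ min n (m v)) :=
  budgetLeLambdaAt_layer_of_padicValNat hodd h414 htors n hres hPT hEP S m hSp hval
    fun v hv κ _ w hw ↦
      exists_mem_unramifiedSubgroup_not_mem_kummerLocalConditionAt_layer_of_odd_of_dvd_localTamagawaNumber
        hodd κ n (hSp v hv) (hcv v hv) w hw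

/-- **THE ROUTE-G BUDGET AT LEVEL `n` FROM THE THREE CENSUS COLUMNS (MAIN, no A40, no reduction-type
hypothesis).** Let `E = W/ℚ` be globally minimal, `p` an odd prime with `p ∤ #E(ℚ)_tors`, `n : ℕ`,
and `S` a finite set of places `v` of `ℚ`, each carrying exactly: `v ∤ p`; a place-count certificate
`v_p(N(v)^{p−1} − 1) = m_v + 1`; `p ∣ c_v`. Then, modulo Greenberg Prop. 4.14 (`h414`),
Poitou–Tate duality over `ℚ_n` (`hPT`) and the local Euler–Poincaré formula at the places of `ℚ_n`
(`hEP`): **`BudgetLeLambdaAt p W (Σ_{v ∈ S} p^{min(n, m_v)})`**. This is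
`budgetLeLambdaAt_layer_of_certificates_noTate` with `hdat` DISCHARGED: `p` odd and `p ∣ c_v`
force additive or split multiplicative reduction at `v`
(`hasAdditiveReductionAt_or_hasSplitMultiplicativeReductionAt_of_dvd_localTamagawaNumber`).
[cite: GreenbergLNM1716, §5 pp. 114–118 and Prop. 4.14] [cite: Washington1997, §13.1 and Prop. 13.2]
[cite: SilvermanATAEC1994, Cor. IV.9.2(d) (PDF p. 340), IV.9.4 Step 2 (PDF p. 344)] -/
theorem budgetLeLambdaAt_layer_of_certificates_of_dvd (hodd : p ≠ 2)
    (h414 : Greenberg1999.prop414_noFiniteSubmodule_of_not_dvd_torsionOrder)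
    (htors : ¬ p ∣ W.torsionOrder) (n : ℕ)
    (hPT : ∀ (κ : ZpExtension ℚ p) [NumberField (κ.layer n)], κ.IsCyclotomic →
      poitouTate_selmerStructure_duality (κ.layer n))
    (hEP : ∀ (κ : ZpExtension ℚ p) [NumberField (κ.layer n)], κ.IsCyclotomic →
      ∀ w : HeightOneSpectrum (𝓞 (κ.layer n)),
      localEulerPoincareCharacteristic (w.adicCompletion (κ.layer n)))
    (S : Finset (HeightOneSpectrum (𝓞 ℚ))) (m : HeightOneSpectrum (𝓞 ℚ) → ℕ)
    (hSp : ∀ v ∈ S, ((p : ℕ) : 𝓞 ℚ) ∉ v.asIdeal)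
    (hval : ∀ v ∈ S, padicValNat p (v.residueCard ^ (p - 1) - 1) = m v + 1)
    (hcv : ∀ v ∈ S,
      p ∣ (W.baseChange (v.adicCompletion ℚ)).localTamagawaNumber (v.adicCompletionIntegers ℚ)) :
    BudgetLeLambdaAt p W (∑ v ∈ S, p ^ min n (m v)) :=
  budgetLeLambdaAt_layer_of_certificates_of_hres_of_dvd hodd h414 htors n
    (fun κ _ _ ↦ ZpTower.exists_selmerInfty_restrictTower_injective W κ n) hPT hEP S m hSp hval hcv

/-- **The residual count at level `n` from the three census columns** (twin of the MAIN, transport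
discharged, no A40, no reduction-type hypothesis; plus finiteness of `Sel_{p^∞}(E/ℚ_∞)[p]`):
`ResidualSelmerRankGeAt p W (Σ_{v ∈ S} p^{min(n, m_v)})`.
[cite: GreenbergLNM1716, §5 pp. 114–118] [cite: Washington1997, §13.1]
[cite: SilvermanATAEC1994, Cor. IV.9.2(d) (PDF p. 340), IV.9.4 Step 2 (PDF p. 344)] -/
theorem residualSelmerRankGeAt_layer_of_certificates_of_dvd (hodd : p ≠ 2)
    (htors : ¬ p ∣ W.torsionOrder) (n : ℕ)
    (hfin : ∀ (κ : ZpExtension ℚ p), κ.IsCyclotomic → Finite {s : W.selmerInfty κ // p • s = 0})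
    (hPT : ∀ (κ : ZpExtension ℚ p) [NumberField (κ.layer n)], κ.IsCyclotomic →
      poitouTate_selmerStructure_duality (κ.layer n))
    (hEP : ∀ (κ : ZpExtension ℚ p) [NumberField (κ.layer n)], κ.IsCyclotomic →
      ∀ w : HeightOneSpectrum (𝓞 (κ.layer n)),
      localEulerPoincareCharacteristic (w.adicCompletion (κ.layer n)))
    (S : Finset (HeightOneSpectrum (𝓞 ℚ))) (m : HeightOneSpectrum (𝓞 ℚ) → ℕ)
    (hSp : ∀ v ∈ S, ((p : ℕ) : 𝓞 ℚ) ∉ v.asIdeal)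
    (hval : ∀ v ∈ S, padicValNat p (v.residueCard ^ (p - 1) - 1) = m v + 1)
    (hcv : ∀ v ∈ S,
      p ∣ (W.baseChange (v.adicCompletion ℚ)).localTamagawaNumber (v.adicCompletionIntegers ℚ)) :
    ResidualSelmerRankGeAt p W (∑ v ∈ S, p ^ min n (m v)) :=
  residualSelmerRankGeAt_layer_of_padicValNat hodd htors n hfin
    (fun κ _ _ ↦ ZpTower.exists_selmerInfty_restrictTower_injective W κ n) hPT hEP S m hSp hval
    fun v hv κ _ w hw ↦
      exists_mem_unramifiedSubgroup_not_mem_kummerLocalConditionAt_layer_of_odd_of_dvd_localTamagawaNumber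
        hodd κ n (hSp v hv) (hcv v hv) w hw

end Summit.BirchSwinnertonDyer.Rank1Residual.Additive

end
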